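import Summits.QuantumAdvantage.AdviceFreeQNC0.AffBells28SubFibre
import HarnessLib

/-!
# `AffBells28.Peeling` PROVED — one peel of the sub-fibre system (planner qn-p1 g28, ROUND-27 §28.2; ask P-28a (i))

Prover seat qn-prover-3 g14.  **`peeling : Peeling`**: if the XOR of the MOD₃ tests of a row set `R` (offsets `c`) is constant on the
sub-fibre `SubFibre x C₀` and `x₁` is a point of it, then for two coins `i ≠ j` of `C₀` the XOR of the tests of the rows SEEING the pair
flip `{i, j}` from `x₁` (`dPair ≠ 0`), with offsets shifted by `dPair`, is constant on `SubFibre x₁ (C₀ ∖ {i, j})` — indeed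
`≡ #(seeing rows) (mod 2)` there (`fires_shift_mod_two`).

Proof (the planner's): a point `x'` of the smaller sub-fibre and its pair flip `x'^{ij} = flipAt x' {i,j}` both lie in `SubFibre x C₀`
(`Fib19`/`AffBells26.kline_flipAt_coins`: two coins, even), and `form β x'^{ij} g = form β x' g + dPair β x₁ g i j` (`form_flipAt`; `x'`
has `x₁`'s pattern on `{i,j}`).  In `fires R x' + fires R x'^{ij}` the blind rows (`dPair = 0`) cancel and each seeing row contributes
`[u + d = c] + [u = c] ≡ 1 + [u = c + d]` (`pair_identity`); the left side is even by `SysConst`.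
WHAT THIS IS NOT: `PeelingList` (induction on the move list) and `Leaf` are NOT proved here; separation NOT moved.
-/

namespace Summit.QuantumAdvantage.AdviceFreeQNC0

namespace AffBells28

open Finset Literature.Computability.QuantumComplexity Literature.Computability.QuantumComplexity.RingHLF
open AffBells23 AffBells26 Fib19

variable {N : ℕ}

/-- Unfolding `SubFibre` membership. -/
theorem mem_subFibre {x x' : Fin N → Bool} {C : Finset (Fin N)} :
    x' ∈ SubFibre x C ↔ IsOdd x' ∧ kline x' = kline x ∧ ∀ i, i ∉ C → x' i = x i := by
  unfold SubFibre
  rw [mem_filter]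
  simp only [mem_univ, true_and]

/-- The pair flip from a point with `x₁`'s pattern on `{i, j}` moves every form by `dPair`. -/
theorem form_flipPair (β : Fin N → Fin N → ZMod 3) {x₁ x' : Fin N → Bool} {i j : Fin N} (hij : i ≠ j) (hi : x' i = x₁ i)
    (hj : x' j = x₁ j) (g : Fin N) : form β (flipAt x' {i, j}) g = form β x' g + dPair β x₁ g i j := by
  rw [form_flipAt, sum_pair hij, hi, hj]
  unfold dPair
  congr 1
  have h : ∀ (b : Bool) (v : ZMod 3), v * (if b then 2 else 1) = if b then -v else v := by
    intro b v
    cases b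
    · simp
    · simp only [if_true]
      have h2 : (2 : ZMod 3) = -1 := by decide
      rw [h2]
      ring
  rw [h, h]

/-- **The peel identity**: `fires c R x' + fires c R x'^{ij} ≡ #R_see + fires (c + dPair) R_see x' (mod 2)`. -/
theorem fires_add_fires_flip (β : Fin N → Fin N → ZMod 3) (c : Fin N → ZMod 3) (R : Finset (Fin N)) {x₁ x' : Fin N → Bool}
    {i j : Fin N} (hij : i ≠ j) (hi : x' i = x₁ i) (hj : x' j = x₁ j) :
    (fires β c R x' + fires β c R (flipAt x' {i, j})) % 2 =
      ((R.filter fun g => dPair β x₁ g i j ≠ 0).card +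
        fires β (fun g => c g + dPair β x₁ g i j) (R.filter fun g => dPair β x₁ g i j ≠ 0) x') % 2 := by
  classical
  have eL : fires β c R x' + fires β c R (flipAt x' {i, j}) =
      ∑ g ∈ R, ((if form β x' g = c g then 1 else 0) + (if form β (flipAt x' {i, j}) g = c g then 1 else 0)) := by
    unfold fires
    rw [card_filter, card_filter, sum_add_distrib]
  have eR : (R.filter fun g => dPair β x₁ g i j ≠ 0).card +
      fires β (fun g => c g + dPair β x₁ g i j) (R.filter fun g => dPair β x₁ g i j ≠ 0) x' =
      ∑ g ∈ R.filter (fun g => dPair β x₁ g i j ≠ 0), (1 + if form β x' g = c g + dPair β x₁ g i j then 1 else 0) := by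
    unfold fires
    rw [card_eq_sum_ones (R.filter fun g => dPair β x₁ g i j ≠ 0), card_filter, ← sum_add_distrib]
  rw [eL, eR, ← sum_filter_add_sum_filter_not R (fun g => dPair β x₁ g i j ≠ 0)]
  have hblind : (∑ g ∈ R.filter (fun g => ¬ dPair β x₁ g i j ≠ 0),
      ((if form β x' g = c g then 1 else 0) + (if form β (flipAt x' {i, j}) g = c g then 1 else 0))) % 2 = 0 := by
    rw [Finset.sum_nat_mod, sum_eq_zero, Nat.zero_mod]
    intro g hg
    rw [mem_filter, not_not] at hg
    rw [form_flipPair β hij hi hj g, hg.2, add_zero]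
    split_ifs <;> rfl
  have hsee : ∀ g ∈ R.filter (fun g => dPair β x₁ g i j ≠ 0),
      ((if form β x' g = c g then 1 else 0) + (if form β (flipAt x' {i, j}) g = c g then 1 else 0)) % 2 =
        (1 + if form β x' g = c g + dPair β x₁ g i j then 1 else 0) % 2 := by
    intro g hg
    rw [mem_filter] at hg
    rw [form_flipPair β hij hi hj g]
    have h3 := pair_identity (form β x' g) (dPair β x₁ g i j) (c g) hg.2
    split_ifs at h3 ⊢ <;> omega
  rw [Nat.add_mod, hblind, add_zero, Nat.mod_mod, Finset.sum_nat_mod, sum_congr rfl hsee, ← Finset.sum_nat_mod]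

/-- **The peel, quantitative form**: on `SubFibre x₁ (C₀ ∖ {i,j})` the shifted XOR of the seeing rows is `≡ #(seeing rows)`. -/
theorem fires_shift_mod_two (hN : 3 ≤ N) (β : Fin N → Fin N → ZMod 3) (c : Fin N → ZMod 3) (R : Finset (Fin N))
    {x : Fin N → Bool} {C₀ : Finset (Fin N)} (hC₀ : C₀ ⊆ klineZeros x) (hS : SysConst β c R x C₀)
    {x₁ : Fin N → Bool} (hx₁ : x₁ ∈ SubFibre x C₀) {i j : Fin N} (hi : i ∈ C₀) (hj : j ∈ C₀) (hij : i ≠ j)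
    {x' : Fin N → Bool} (hx' : x' ∈ SubFibre x₁ ((C₀.erase i).erase j)) :
    fires β (fun g => c g + dPair β x₁ g i j) (R.filter fun g => dPair β x₁ g i j ≠ 0) x' % 2 =
      (R.filter fun g => dPair β x₁ g i j ≠ 0).card % 2 := by
  rw [mem_subFibre] at hx₁ hx'
  obtain ⟨hodd', hk', hagree'⟩ := hx'
  obtain ⟨-, hk₁, hagree₁⟩ := hx₁
  have hi' : x' i = x₁ i := hagree' i (by
    intro h; rw [mem_erase, mem_erase] at h; exact h.2.1 rfl)
  have hj' : x' j = x₁ j := hagree' j (by intro h; rw [mem_erase] at h; exact h.1 rfl)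
  -- both x' and its pair flip lie in SubFibre x C₀
  have hkx' : kline x' = kline x := hk'.trans hk₁
  have hmem1 : x' ∈ SubFibre x C₀ := by
    rw [mem_subFibre]
    refine ⟨hodd', hkx', fun k hk => ?_⟩
    rw [hagree' k (fun h => hk (mem_of_mem_erase (mem_of_mem_erase h))), hagree₁ k hk]
  have hP : ∀ k ∈ ({i, j} : Finset (Fin N)), kline x' k = false := by
    intro k hk
    rw [hkx']
    rw [mem_insert, mem_singleton] at hk
    have hkC : k ∈ C₀ := by rcases hk with rfl | rfl <;> assumption
    have := hC₀ hkC
    unfold klineZeros at this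
    rw [mem_filter] at this
    exact this.2
  obtain ⟨hodd2, hk2⟩ := kline_flipAt_coins hN x' hodd' {i, j} hP (by rw [card_pair hij])
  have hmem2 : flipAt x' {i, j} ∈ SubFibre x C₀ := by
    rw [mem_subFibre]
    refine ⟨hodd2, hk2.trans hkx', fun k hk => ?_⟩
    have hkij : k ∉ ({i, j} : Finset (Fin N)) := by
      rw [mem_insert, mem_singleton]
      rintro (rfl | rfl)
      · exact hk hi
      · exact hk hj
    rw [flipAt_apply_of_not_mem hkij, hagree' k (fun h => hk (mem_of_mem_erase (mem_of_mem_erase h))), hagree₁ k hk]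
  have hsys := hS x' hmem1 (flipAt x' {i, j}) hmem2
  have hid := fires_add_fires_flip β c R hij hi' hj'
  omega

/-- **`Peeling` holds.** -/
theorem peeling : Peeling := by
  intro N hN β c R x C₀ _ hC₀ hS x₁ hx₁ i hi j hj hij x' hx' x'' hx''
  rw [fires_shift_mod_two hN β c R hC₀ hS hx₁ hi hj hij hx', fires_shift_mod_two hN β c R hC₀ hS hx₁ hi hj hij hx'']

end AffBells28

end Summit.QuantumAdvantage.AdviceFreeQNC0
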